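import HarnessLib
import Summits.RiemannHypothesis.RiemannHypothesis.Theorems.SignConePointwiseCertSevenFifthsGroups0
import Summits.RiemannHypothesis.RiemannHypothesis.Theorems.SignConePointwiseCertSevenFifthsGroups1
import Summits.RiemannHypothesis.RiemannHypothesis.Theorems.SignConePointwiseCertSevenFifthsGroups2
import Summits.RiemannHypothesis.RiemannHypothesis.Theorems.SignConePointwiseCertSevenFifthsGroups3
import Summits.RiemannHypothesis.RiemannHypothesis.Theorems.SignConePointwiseCertSevenFifthsGroups4
import Summits.RiemannHypothesis.RiemannHypothesis.Theorems.SignConePointwiseCertSevenFifthsGroups5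
import Summits.RiemannHypothesis.RiemannHypothesis.Theorems.SignConePointwiseCertSevenFifthsGroups6
import Summits.RiemannHypothesis.RiemannHypothesis.Theorems.SignConePointwiseCertSevenFifthsGroups7
import Summits.RiemannHypothesis.RiemannHypothesis.Theorems.SignConePointwiseCertSevenFifthsGroups8
import Summits.RiemannHypothesis.RiemannHypothesis.Theorems.SignConePointwiseCertSevenFifthsGroups9
import Summits.RiemannHypothesis.RiemannHypothesis.Theorems.SignConePointwiseCertSevenFifthsGroups10
import Summits.RiemannHypothesis.RiemannHypothesis.Theorems.SignConePointwiseCertSevenFifthsGroups11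
import Summits.RiemannHypothesis.RiemannHypothesis.Theorems.SignConePointwiseCertSevenFifthsGroups12
import Summits.RiemannHypothesis.RiemannHypothesis.Theorems.SignConePointwiseCertSevenFifthsGroups13
import Summits.RiemannHypothesis.RiemannHypothesis.Theorems.SignConePointwiseCertSevenFifthsGroups14

/-!
# Route SignCone: pointwise certificate `pwCert75` — assembly: the density is non-negative

Support for the unconditional rungs of `SignConeOscillatory` / `SignConeInequality`
(items stmt-RiemannHypothesis-16302 / 16301). The anchored grid groups of `SignConePointwiseCertSevenFifthsGroups*.lean`
chain from `0` to `Y₀ = 183` (`pwCert75_chain`), so by `PWData.F_add_Hsos_nonneg_of_checksZ` (corrected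
fast checker, `SignConePointwiseCheckerZSound.lean`) the CORRECTED density of the certificate `pwCert75`
is non-negative on the whole real line (`pwCert75_FH_nonneg`):

  `0 ≤ Re ψ(1/4 + iy/2) − log π + s + Ê_χ(y) − Σ_n a_n cos(y log n) + Hsos(y)`  for all real `y`,

where `Hsos` has all its frequencies outside the window `[-2b, 2b]` (`SOSData.Hsos_frequencies`).
-/

-- `Summit.RiemannHypothesis.RiemannHypothesis.…` repeats a namespace component by design (D-0017 layout).
set_option linter.dupNamespace false

noncomputable section

namespace Summit.RiemannHypothesis.RiemannHypothesis.Theorems.SignCone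

open Literature.Analysis.ValidatedNumerics.Numerics Literature.NumberTheory.LFunctions

/-- All anchored grid groups of the certificate. [folklore] -/
def pwCert75Groups : List (ℚ × List ℚ) := pwCert75G0 ++ (pwCert75G1 ++ (pwCert75G2 ++ (pwCert75G3 ++ (pwCert75G4 ++ (pwCert75G5 ++ (pwCert75G6 ++ (pwCert75G7 ++ (pwCert75G8 ++ (pwCert75G9 ++ (pwCert75G10 ++ (pwCert75G11 ++ (pwCert75G12 ++ (pwCert75G13 ++ pwCert75G14)))))))))))))

set_option maxHeartbeats 0 in
/-- The point lists chain from `0` to `Y₀ = 183`. [folklore] -/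
theorem pwCert75_chain : PWData.chainOK (pwCert75Groups.map Prod.snd) 0 183 = true := by
  decide +kernel

/-- Every group passes the corrected fast checker. [folklore] -/
theorem pwCert75_groups_all : ∀ g ∈ pwCert75Groups, pwCert75.checkAGrid₂Z pwCert75cs pwCert75logs pwCert75fac pwCert75hl g = true :=
  List.forall_mem_append.2 ⟨pwCert75_groups0, List.forall_mem_append.2 ⟨pwCert75_groups1, List.forall_mem_append.2 ⟨pwCert75_groups2, List.forall_mem_append.2 ⟨pwCert75_groups3, List.forall_mem_append.2 ⟨pwCert75_groups4, List.forall_mem_append.2 ⟨pwCert75_groups5, List.forall_mem_append.2 ⟨pwCert75_groups6, List.forall_mem_append.2 ⟨pwCert75_groups7, List.forall_mem_append.2 ⟨pwCert75_groups8, List.forall_mem_append.2 ⟨pwCert75_groups9, List.forall_mem_append.2 ⟨pwCert75_groups10, List.forall_mem_append.2 ⟨pwCert75_groups11, List.forall_mem_append.2 ⟨pwCert75_groups12, List.forall_mem_append.2 ⟨pwCert75_groups13, pwCert75_groups14⟩⟩⟩⟩⟩⟩⟩⟩⟩⟩⟩⟩⟩⟩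

/-- **The corrected density of `pwCert75` is non-negative**: `∀ y, 0 ≤ pwCert75.F y + pwCert75sos.Hsos y`. [folklore] -/
theorem pwCert75_FH_nonneg (y : ℝ) : 0 ≤ pwCert75.F y + pwCert75sos.Hsos y :=
  PWData.F_add_Hsos_nonneg_of_checksZ pwCert75_checkScalars pwCert75_tables pwCert75_hterms pwCert75_tailH
    pwCert75fac pwCert75Groups pwCert75_chain pwCert75_groups_all y

end Summit.RiemannHypothesis.RiemannHypothesis.Theorems.SignCone

end
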